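import Summits.ABC.IUTFork.Joshi.MultiplicativeStructuresJoshi
import Mathlib.Algebra.CharP.Lemmas

/-!
# [J-2½] Thm. 3.5.1 AS TYPED (`ATS2half.Thm351`, group level) is refutable in characteristic `p` — a kernel flag for the referee
# lanes (companion of E-t38's `Joshi/MultiplicativeStructuresJoshi.lean`, p432965; co-typer note of abc-iut-E-t13)

Block E of the abc-iut cell (rung LADDER-ABC:A2.E; seat abc-iut-E-t13, co-typer of E-t38 on [J-2½] §3). SOURCE: K. Joshi, arXiv:2305.10398v12
(`Joshi2023ATS2half`, UNREFEREED, disputed), Thm. 3.5.1 p. 19 l. 27–40: «Let `F` be an algebraically closed perfectoid field of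
characteristic `p > 0` … Then one has an isomorphism of the `ℤ_p`-modules `(𝔪_F, +) →^{AH} (1 + 𝔪_F, ×)`, where `AH` is the Artin-Hasse
exponential». E-t38 typed it at GROUP level as `Thm351 hvF hnaF : ∃ e : 𝔪 ≃ 1 + 𝔪, ∀ a b, e (a + b) = e a · e b` (flagging that the
`ℤ_p`-linearity and the Artin–Hasse series are not typed).

KERNEL FACT (PROVED below, standard algebra, no side taken): over ANY field `F` of characteristic `p` carrying a non-archimedean absolute
value in E-t37's sense (`ATS2h.IsValuedField`, `IsNonarchimedeanAbs`) with a nonzero element of absolute value `< 1` — e.g. `𝔽_p((t))` or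
`ℂ_p♭`, the fields print has in mind (not constructed here) — there is NO bijection `𝔪_F ≃ 1 + 𝔪_F` turning `+` into `·`: `(𝔪_F, +)` is
killed by `p` while `1 + 𝔪_F` has no `p`-torsion (`(1 + y)^p = 1 + y^p`). Hence `¬ Thm351` as typed (`not_thm351_of_charP`).

READING CONSEQUENCE (located, NOT adjudicated; double-read wanted — E-ref [J-2½] lane / E-t38): print's sentence cannot hold with the
ORDINARY addition on `𝔪_F`; the cited statements [FF18, Prop. 2.3.10, Ex. 2.3.11, Ex. 4.4.7] concern the Lubin–Tate / `Ĝ_m` structures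
(`(1 + 𝔪_F, ×)` is even a `ℚ_p`-vector space for perfect `F`), so either `(𝔪_F, +)` denotes a transported structure or the map `AH` is a
bijection of another kind — a READING QUESTION for the sheet, in the class of E-t60's `¬Prop231Literal` (J-FALSE for the LITERAL sentence
only). Nothing here bears on [IUTchIII] Cor. 3.12; typed ≠ proved ≠ endorsed. Standard axioms; sorry-free.
-/

noncomputable section

namespace Summit.ABC.IUTFork.Joshi.ATS2half

open Summit.ABC.IUTFork.Joshi.ATS2h (IsValuedField)

universe u

variable {F : Type u} [Field F] {absF : F → ℝ}

/-- `0 ∉ 1 + 𝔪`: `|0 − 1| = |−1| = 1`. [folklore] -/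
theorem zero_not_mem_oneUnits (hv : IsValuedField absF) (hna : IsNonarchimedeanAbs absF) : (0 : F) ∉ oneUnits hv hna := by
  rw [mem_oneUnits_iff, zero_sub, abs_neg_of_valued hv, hv.map_one]
  exact lt_irrefl 1

/-- An additive-to-multiplicative map `e : 𝔪 → 1 + 𝔪` sends `0` to `1`. [folklore] -/
theorem coe_map_zero_eq_one (hv : IsValuedField absF) (hna : IsNonarchimedeanAbs absF)
    (e : maxIdeal hv hna ≃ oneUnits hv hna) (he : ∀ a b, (e (a + b) : F) = e a * e b) : ((e 0 : oneUnits hv hna) : F) = 1 := by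
  have h := he 0 0
  rw [add_zero] at h
  have hne : ((e 0 : oneUnits hv hna) : F) ≠ 0 := fun h0 =>
    zero_not_mem_oneUnits hv hna (h0 ▸ (e 0).2)
  -- `y = y * y` with `y ≠ 0` forces `y = 1`
  have : ((e 0 : oneUnits hv hna) : F) * 1 = (e 0 : F) * (e 0 : F) := by rw [mul_one]; exact h
  exact (mul_left_cancel₀ hne this).symm

/-- An additive-to-multiplicative map sends `n • a` to the `n`-th power. [folklore] -/
theorem coe_map_nsmul (hv : IsValuedField absF) (hna : IsNonarchimedeanAbs absF) (e : maxIdeal hv hna ≃ oneUnits hv hna)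
    (he : ∀ a b, (e (a + b) : F) = e a * e b) (a : maxIdeal hv hna) (n : ℕ) :
    ((e (n • a) : oneUnits hv hna) : F) = ((e a : oneUnits hv hna) : F) ^ n := by
  induction n with
  | zero => rw [zero_nsmul, pow_zero]; exact coe_map_zero_eq_one hv hna e he
  | succ n ih => rw [succ_nsmul, he, ih, pow_succ]

/-- **`¬ Thm351` in characteristic `p`**: for a field of characteristic `p` with a non-archimedean absolute value and a nonzero element
of absolute value `< 1`, NO bijection `𝔪_F ≃ 1 + 𝔪_F` turns addition into multiplication (`p • a = 0` but `(1 + y)^p = 1 ⟹ y = 0`). So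
E-t38's group-level typing of [J-2½] Thm. 3.5.1 is refutable for the characteristic-`p` perfectoid `F` print speaks of — the printed
sentence needs another reading of «`(𝔪_F, +)`» (located for the referee lanes, not adjudicated). PROVED. [folklore] -/
theorem not_thm351_of_charP (p : ℕ) [hp : Fact p.Prime] [CharP F p] [TopologicalSpace F] (hv : IsValuedField absF)
    (hna : IsNonarchimedeanAbs absF) (hm : ∃ x : F, x ≠ 0 ∧ absF x < 1) : ¬ Thm351 F absF hv hna := by
  rintro ⟨e, he⟩
  obtain ⟨x, hx0, hx1⟩ := hm
  let a : maxIdeal hv hna := ⟨x, hx1⟩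
  -- `p • a = 0` in characteristic `p`
  have hpa : p • a = 0 := by
    apply Subtype.ext
    show ((p • a : maxIdeal hv hna) : F) = 0
    rw [AddSubgroupClass.coe_nsmul, nsmul_eq_mul, CharP.cast_eq_zero, zero_mul]
  -- hence `(e a)^p = e 0 = 1`
  have hpow : ((e a : oneUnits hv hna) : F) ^ p = 1 := by
    rw [← coe_map_nsmul hv hna e he a p, hpa, coe_map_zero_eq_one hv hna e he]
  -- in characteristic `p`: `(e a − 1)^p = (e a)^p − 1 = 0`, so `e a = 1 = e 0`
  have hsub : (((e a : oneUnits hv hna) : F) - 1) ^ p = 0 := by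
    rw [sub_pow_char, one_pow, hpow, sub_self]
  have hea : ((e a : oneUnits hv hna) : F) = 1 := sub_eq_zero.1 (pow_eq_zero_iff hp.out.ne_zero |>.1 hsub)
  have hea0 : e a = e 0 := Subtype.ext (hea.trans (coe_map_zero_eq_one hv hna e he).symm)
  have ha0 : a = 0 := e.injective hea0
  exact hx0 (congrArg Subtype.val ha0)

end Summit.ABC.IUTFork.Joshi.ATS2half

end
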